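import Mathlib
import HarnessLib

/-!
# The star–triangle transformation for Bernoulli bond percolation: the local coupling

The star–triangle (Kennelly 1899; Yang–Baxter) transformation for bond percolation, in the
coupling form of Grimmett–Manolescu (*Inhomogeneous bond percolation on square, triangular and
hexagonal lattices*, Ann. Probab. 41 (2013), §2.1, Propositions 2.1–2.2 and Figure 5) and of
Duminil-Copin–Kozlowski–Krachun–Manolescu–Oulamara (arXiv:2012.11672v2 (2026), §2.6,
Definition 2.9 at `q = 1`), which is the elementary step of the track-exchange operators of
DKKMO §2.6 (Definition 2.10, Proposition 2.11) driving the proof of their Theorems 1.9 / 1.7.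

**Setting (local form).** A triangle `ABC` with vertices labelled by `Fin 3` and a star
`ABCO`. Configurations of the three triangle edges are `t : Fin 3 → Bool`, where `t k` is the
state of the edge *opposite* the vertex `k` (so `t 0` is the edge `BC`); configurations of the
three star edges are `s : Fin 3 → Bool`, where `s k` is the state of the edge `Ok`. The triangle
carries the product measure `P^△_p` with parameters `p = (p₀, p₁, p₂) ∈ [0, 1)³` (`law p`), the
star the product measure `P^☆_{1−p}` (`law (1 − p)`); `p` is *self-dual* when
`κ_△(p) = p₀ + p₁ + p₂ − p₀p₁p₂ − 1 = 0` (GM13 eq. (2)). For critical isoradial weights the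
star edge `Ok` is the other diagonal of a rhombus congruent to that of the triangle edge
opposite `k`, whence the parameter `1 − p_k`.

**The coupling `T`** (GM13 Figure 5; DKKMO Definition 2.9 with `q = 1`,
`p_{OA} = 1 − p_{BC}`, …): given the triangle configuration,
* two or three open edges ↦ the full star;
* exactly one open edge, `BC` say ↦ `OB`, `OC` open and `OA` closed (in labels: `s = ¬ ∘ t`);
* no open edge ↦ the empty star with probability `∏ₖ p_k/(1 − p_k)`, or the single edge `Ok`
  with probability `∏_{j ≠ k} p_j/(1 − p_j)` (DKKMO: "no open edge with probability
  `∏ (1 − p_{OX})/p_{OX}`; the edge `OA` is open and the other two closed with probability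
  `q (1 − p_{OB})/p_{OB} · (1 − p_{OC})/p_{OC}`").
We realise it as an explicit measure `coupling p` on pairs `(t, s)` (`kernelWeight` is the
transition probability) and prove:

* `sum_kernelWeight` — the transition probabilities sum to `1` (this is where self-duality
  enters: "since `κ_△(p) = 0`, the probabilities in the first and last rows sum to `1`");
* `map_fst_coupling`, `map_snd_coupling` — **GM13 Proposition 2.2, first half / DKKMO (17) for
  one star–triangle move**: the marginals of `coupling p` are `P^△_p` and `P^☆_{1−p}`;
* `compatible_of_kernelWeight_ne_zero`, `coupling_not_compatible` — **GM13 Proposition 2.2,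
  second half / DKKMO "the coupling preserves the connectivity between the vertices, except at
  the vertex `O`"**: the coupling is supported on pairs `(t, s)` inducing the same connections
  among `A, B, C` (`TriConn`, `StarConn`, `Compatible`);
* `law_triConn_eq_law_starConn` — **GM13 Proposition 2.1** (Grimmett, *Percolation* (1999),
  §11.9): the families of connection events among `A, B, C` have the same law under `P^△_p` and
  `P^☆_{1−p}`;
* `triConn_iff_reachable`, `starConn_iff_reachable`, `compatible_iff_reachable` — the
  connection predicates are open-path connectivity (`SimpleGraph.Reachable`) in the open
  subgraphs `triGraph t` of the triangle and `starGraph s` of the star.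

The global form (a triangle inside an arbitrary graph, the other edges untouched; DKKMO
Definition 2.9 first bullet, GM13 §2.2) and the track exchange are the next layer.

## References

* G. R. Grimmett, I. Manolescu, *Inhomogeneous bond percolation on square, triangular and
  hexagonal lattices*, Ann. Probab. 41 (2013) 2990–3025, arXiv:1105.5535: §1.2 eq. (2)
  (`κ_△`), §2.1, Propositions 2.1, 2.2, Figure 5.
* H. Duminil-Copin, K. K. Kozlowski, D. Krachun, I. Manolescu, M. Oulamara, *Rotational
  invariance in critical planar lattice models*, arXiv:2012.11672v2 (2026): §2.6,
  Definition 2.9, eq. (17), Proposition 2.11.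
* G. Grimmett, *Percolation*, 2nd ed., Springer (1999), §11.9 (star–triangle transformation).
* A. E. Kennelly, Electrical World and Engineer 34 (1899), 413–414.
-/

noncomputable section

open MeasureTheory Finset
open scoped ENNReal NNReal

namespace Literature.Probability.Percolation

namespace StarTriangle

/-! ### Configurations of three labelled edges and their product laws -/

/-- The three coordinates of a configuration, as a triple (bookkeeping for finite sums). [folklore] -/
def tripleEquiv : (Fin 3 → Bool) ≃ Bool × Bool × Bool where
  toFun t := (t 0, t 1, t 2)
  invFun x := ![x.1, x.2.1, x.2.2]
  left_inv t := by funext i; fin_cases i <;> rfl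
  right_inv x := by rfl

/-- A sum over the eight configurations of three edges, expanded. [folklore] -/
theorem sum_eq {M : Type*} [AddCommMonoid M] (f : (Fin 3 → Bool) → M) :
    ∑ t, f t = f ![true, true, true] + f ![true, true, false] + f ![true, false, true] +
      f ![true, false, false] + f ![false, true, true] + f ![false, true, false] +
      f ![false, false, true] + f ![false, false, false] := by
  rw [← Fintype.sum_equiv tripleEquiv.symm (fun x => f (tripleEquiv.symm x)) f (fun _ => rfl)]
  simp only [Fintype.sum_prod_type, Fintype.sum_bool]
  simp only [tripleEquiv, Equiv.coe_fn_symm_mk]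
  abel

/-- Every configuration of three edges is one of the eight explicit ones (case analysis
helper). [folklore] -/
theorem eq_vec (t : Fin 3 → Bool) : t = ![t 0, t 1, t 2] := by
  funext i; fin_cases i <;> rfl

/-- **GM13's `κ_△`**: `κ_△(p) = p₀ + p₁ + p₂ − p₀ p₁ p₂ − 1`; the parameters `p` of the
triangle are *self-dual* when `κ_△(p) = 0` (for the homogeneous triangular lattice,
`3p − p³ = 1`, `p = 2 sin(π/18)`). (Grimmett–Manolescu 2013, §1.2, eq. (2).) [cite: GrimmettManolescuAOP2013, eq. (2)] -/
def kappa (p : Fin 3 → ℝ) : ℝ := p 0 + p 1 + p 2 - p 0 * p 1 * p 2 - 1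

/-- The odds `p_k / (1 − p_k)` of the triangle edge opposite `k` (equivalently
`(1 − p_{Ok}) / p_{Ok}` for the star edge at `k`, of parameter `1 − p_k`). [cite: arXiv201211672v2, Def 2.9] -/
def odds (p : Fin 3 → ℝ) (k : Fin 3) : ℝ := p k / (1 - p k)

/-- The Bernoulli law with parameter `r` on `Bool` (`r` is meant to lie in `[0, 1]`). [folklore] -/
def ber (r : ℝ) : Measure Bool :=
  (r.toNNReal) • Measure.dirac true + ((1 - r).toNNReal) • Measure.dirac false

/-- `ber r {true} = r`. [folklore] -/
@[simp] theorem ber_apply_true (r : ℝ) : ber r {true} = ENNReal.ofReal r := by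
  simp [ber, ENNReal.ofReal]

/-- `ber r {false} = 1 − r`. [folklore] -/
@[simp] theorem ber_apply_false (r : ℝ) : ber r {false} = ENNReal.ofReal (1 - r) := by
  simp [ber, ENNReal.ofReal]

/-- `ber r` is a finite measure. [folklore] -/
instance (r : ℝ) : IsFiniteMeasure (ber r) := by unfold ber; infer_instance

/-- **The product law `P_p` of three independent edges** with parameters `p k` (GM13's
`P^△_p` on the triangle, `P^☆_{1−p}` on the star is `law (1 − p)`). (Grimmett–Manolescu
2013, §1.2 and §2.1.) [cite: GrimmettManolescuAOP2013, §2.1] -/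
def law (p : Fin 3 → ℝ) : Measure (Fin 3 → Bool) := Measure.pi fun k => ber (p k)

/-- The weight `∏ₖ p_k^{t_k} (1 − p_k)^{1 − t_k}` of a configuration. [folklore] -/
def weight (p : Fin 3 → ℝ) (t : Fin 3 → Bool) : ℝ := ∏ k, if t k then p k else 1 - p k

/-- The weight of a configuration is nonnegative for `p ∈ [0, 1]³`. [folklore] -/
theorem weight_nonneg {p : Fin 3 → ℝ} (hp : ∀ k, p k ∈ Set.Icc (0 : ℝ) 1) (t : Fin 3 → Bool) :
    0 ≤ weight p t :=
  Finset.prod_nonneg fun k _ => by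
    rcases hp k with ⟨h0, h1⟩
    split_ifs <;> linarith

/-- `P_p{t} = ∏ₖ p_k^{t_k} (1 − p_k)^{1 − t_k}`. [folklore] -/
theorem law_singleton {p : Fin 3 → ℝ} (hp : ∀ k, p k ∈ Set.Icc (0 : ℝ) 1) (t : Fin 3 → Bool) :
    law p {t} = ENNReal.ofReal (weight p t) := by
  rw [law, ← Set.univ_pi_singleton t, Measure.pi_pi, weight,
    ENNReal.ofReal_prod_of_nonneg (fun k _ => by
      rcases hp k with ⟨h0, h1⟩
      split_ifs <;> linarith)]
  refine Finset.prod_congr rfl fun k _ => ?_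
  cases t k <;> simp

/-- `P_p` is a probability measure for `p ∈ [0, 1]³`. [folklore] -/
theorem isProbabilityMeasure_law {p : Fin 3 → ℝ} (hp : ∀ k, p k ∈ Set.Icc (0 : ℝ) 1) :
    IsProbabilityMeasure (law p) := by
  haveI : ∀ k, IsProbabilityMeasure (ber (p k)) := fun k => by
    refine ⟨?_⟩
    rcases hp k with ⟨h0, h1⟩
    have huniv : (Set.univ : Set Bool) = {true} ∪ {false} := by ext b; cases b <;> simp
    rw [huniv, measure_union (by simp) (measurableSet_singleton _), ber_apply_true, ber_apply_false,
      ← ENNReal.ofReal_add h0 (by linarith), add_sub_cancel, ENNReal.ofReal_one]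
  unfold law
  infer_instance

/-! ### The star–triangle kernel and coupling -/

/-- **The transition probabilities of the star–triangle coupling `T`** (GM13 Figure 5; DKKMO
Definition 2.9 at `q = 1`): `kernelWeight p t s` is the probability that the triangle
configuration `t` is sent to the star configuration `s` — full star if at least two triangle
edges are open; the two star edges at the endpoints of the unique open triangle edge if there
is exactly one; and, if the triangle is empty, the empty star with probability
`∏ₖ p_k/(1 − p_k)` or the single star edge `Ok` with probability `∏_{j ≠ k} p_j/(1 − p_j)`.
(Grimmett–Manolescu 2013, Figure 5; DKKMO, arXiv:2012.11672v2, Definition 2.9.) [cite: arXiv201211672v2, Def 2.9] -/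
def kernelWeight (p : Fin 3 → ℝ) (t s : Fin 3 → Bool) : ℝ :=
  match t 0, t 1, t 2, s 0, s 1, s 2 with
  -- no open triangle edge: the empty star or a single star edge
  | false, false, false, false, false, false => odds p 0 * odds p 1 * odds p 2
  | false, false, false, true, false, false => odds p 1 * odds p 2
  | false, false, false, false, true, false => odds p 0 * odds p 2
  | false, false, false, false, false, true => odds p 0 * odds p 1
  -- exactly one open triangle edge (opposite `k`): the two star edges not at `k`
  | true, false, false, false, true, true => 1
  | false, true, false, true, false, true => 1
  | false, false, true, true, true, false => 1
  -- two or three open triangle edges: the full star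
  | true, true, false, true, true, true => 1
  | true, false, true, true, true, true => 1
  | false, true, true, true, true, true => 1
  | true, true, true, true, true, true => 1
  | _, _, _, _, _, _ => 0

/-- Transition probabilities are nonnegative for `p ∈ [0, 1)³`. [folklore] -/
theorem kernelWeight_nonneg {p : Fin 3 → ℝ} (hp : ∀ k, p k ∈ Set.Ico (0 : ℝ) 1) (t s : Fin 3 → Bool) :
    0 ≤ kernelWeight p t s := by
  have ho : ∀ k, 0 ≤ odds p k := fun k => div_nonneg (hp k).1 (by linarith [(hp k).2])
  obtain ⟨a, b, c, rfl⟩ : ∃ a b c, t = ![a, b, c] := ⟨t 0, t 1, t 2, eq_vec t⟩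
  obtain ⟨x, y, z, rfl⟩ : ∃ x y z, s = ![x, y, z] := ⟨s 0, s 1, s 2, eq_vec s⟩
  have h3 := mul_nonneg (mul_nonneg (ho 0) (ho 1)) (ho 2)
  have h12 := mul_nonneg (ho 1) (ho 2)
  have h02 := mul_nonneg (ho 0) (ho 2)
  have h01 := mul_nonneg (ho 0) (ho 1)
  cases a <;> cases b <;> cases c <;> cases x <;> cases y <;> cases z <;>
    simp [kernelWeight, h3, h12, h02, h01]

/-- **The transition probabilities sum to one** ("since `κ_△(p) = 0`, the probabilities in the
first and last rows sum to `1`", GM13, caption of Figure 5): for self-dual `p ∈ [0, 1)³`,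
`∑ₛ kernelWeight p t s = 1` for every `t`; for the empty triangle this is the identity
`p₀p₁p₂ + Σ_k (1 − p_k) ∏_{j≠k} p_j = ∏ₖ (1 − p_k)`, i.e. `κ_△(p) = 0`. [cite: GrimmettManolescuAOP2013, Fig. 5] -/
theorem sum_kernelWeight {p : Fin 3 → ℝ} (hp : ∀ k, p k ∈ Set.Ico (0 : ℝ) 1) (hκ : kappa p = 0)
    (t : Fin 3 → Bool) : ∑ s, kernelWeight p t s = 1 := by
  have h0 : 1 - p 0 ≠ 0 := by linarith [(hp 0).2]
  have h1 : 1 - p 1 ≠ 0 := by linarith [(hp 1).2]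
  have h2 : 1 - p 2 ≠ 0 := by linarith [(hp 2).2]
  obtain ⟨a, b, c, rfl⟩ : ∃ a b c, t = ![a, b, c] := ⟨t 0, t 1, t 2, eq_vec t⟩
  rw [sum_eq]
  have hκ' : p 0 + p 1 + p 2 - p 0 * p 1 * p 2 - 1 = 0 := hκ
  cases a <;> cases b <;> cases c <;> simp [kernelWeight]
  -- the empty triangle
  unfold odds
  field_simp
  linear_combination hκ'

/-- **The star–triangle coupling** of `P^△_p` and `P^☆_{1−p}` (GM13 Proposition 2.2; DKKMO
Definition 2.9 at `q = 1`), as a measure on pairs (triangle configuration, star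
configuration): mass `P^△_p{t} · kernelWeight p t s` at `(t, s)`. [cite: arXiv201211672v2, Def 2.9] -/
def coupling (p : Fin 3 → ℝ) : Measure ((Fin 3 → Bool) × (Fin 3 → Bool)) :=
  ∑ t, ∑ s, ENNReal.ofReal (weight p t * kernelWeight p t s) • Measure.dirac (t, s)

/-- The mass of a measurable set under the coupling, as a finite sum. [folklore] -/
theorem coupling_apply (p : Fin 3 → ℝ) (A : Set ((Fin 3 → Bool) × (Fin 3 → Bool))) :
    coupling p A = ∑ t, ∑ s, ENNReal.ofReal (weight p t * kernelWeight p t s) * A.indicator 1 (t, s) := by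
  simp only [coupling, Measure.coe_finsetSum, Finset.sum_apply, Measure.smul_apply, smul_eq_mul,
    Measure.dirac_apply]

/-- **First marginal: the triangle** (GM13 Proposition 2.2: "`ω` sampled from `P^△_p`"). For
self-dual `p ∈ [0, 1)³` the first marginal of `coupling p` is `P^△_p`. [cite: GrimmettManolescuAOP2013, Prop 2.2] -/
theorem map_fst_coupling {p : Fin 3 → ℝ} (hp : ∀ k, p k ∈ Set.Ico (0 : ℝ) 1) (hκ : kappa p = 0) :
    (coupling p).map Prod.fst = law p := by
  have hp' : ∀ k, p k ∈ Set.Icc (0 : ℝ) 1 := fun k => ⟨(hp k).1, (hp k).2.le⟩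
  refine Measure.ext_iff_singleton.2 fun t₀ => ?_
  rw [Measure.map_apply measurable_fst (measurableSet_singleton t₀), coupling_apply,
    law_singleton hp' t₀, Finset.sum_eq_single t₀ (fun t _ ht => ?_) (fun h => (h (mem_univ _)).elim)]
  · have hind : ∀ s : Fin 3 → Bool,
        (Prod.fst ⁻¹' ({t₀} : Set (Fin 3 → Bool))).indicator (1 : (Fin 3 → Bool) × (Fin 3 → Bool) → ℝ≥0∞) (t₀, s) = 1 :=
      fun s => by simp
    simp only [hind, mul_one]
    rw [← ENNReal.ofReal_sum_of_nonneg (fun s _ => mul_nonneg (weight_nonneg hp' t₀) (kernelWeight_nonneg hp t₀ s)),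
      ← Finset.mul_sum, sum_kernelWeight hp hκ, mul_one]
  · refine Finset.sum_eq_zero fun s _ => ?_
    have hind : (Prod.fst ⁻¹' ({t₀} : Set (Fin 3 → Bool))).indicator
        (1 : (Fin 3 → Bool) × (Fin 3 → Bool) → ℝ≥0∞) (t, s) = 0 := by simp [ht]
    rw [hind, mul_zero]

/-- The eight identities behind the second marginal: `Σₜ P^△_p{t} · kernelWeight p t s =
P^☆_{1−p}{s}`; only the full star uses self-duality. [cite: GrimmettManolescuAOP2013, Prop 2.2] -/
theorem sum_weight_mul_kernelWeight {p : Fin 3 → ℝ} (hp : ∀ k, p k ∈ Set.Ico (0 : ℝ) 1)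
    (hκ : kappa p = 0) (s : Fin 3 → Bool) :
    ∑ t, weight p t * kernelWeight p t s = weight (fun k => 1 - p k) s := by
  have h0 : 1 - p 0 ≠ 0 := by linarith [(hp 0).2]
  have h1 : 1 - p 1 ≠ 0 := by linarith [(hp 1).2]
  have h2 : 1 - p 2 ≠ 0 := by linarith [(hp 2).2]
  obtain ⟨x, y, z, rfl⟩ : ∃ x y z, s = ![x, y, z] := ⟨s 0, s 1, s 2, eq_vec s⟩
  rw [sum_eq]
  have hκ' : p 0 + p 1 + p 2 - p 0 * p 1 * p 2 - 1 = 0 := hκ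
  cases x <;> cases y <;> cases z <;> simp [kernelWeight, weight, Fin.prod_univ_three, odds]
  all_goals field_simp
  all_goals first | ring1 | linear_combination hκ'

/-- **Second marginal: the star** (GM13 Proposition 2.2: "`T(ω)` has the same law as `ω'`",
i.e. `P^☆_{1−p}`; DKKMO eq. (17) for a single star–triangle move). For self-dual
`p ∈ [0, 1)³` the second marginal of `coupling p` is `P^☆_{1−p} = law (1 − p)`. [cite: GrimmettManolescuAOP2013, Prop 2.2] -/
theorem map_snd_coupling {p : Fin 3 → ℝ} (hp : ∀ k, p k ∈ Set.Ico (0 : ℝ) 1) (hκ : kappa p = 0) :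
    (coupling p).map Prod.snd = law (fun k => 1 - p k) := by
  have hp' : ∀ k, p k ∈ Set.Icc (0 : ℝ) 1 := fun k => ⟨(hp k).1, (hp k).2.le⟩
  have hq' : ∀ k, 1 - p k ∈ Set.Icc (0 : ℝ) 1 := fun k => ⟨by linarith [(hp k).2], by linarith [(hp k).1]⟩
  refine Measure.ext_iff_singleton.2 fun s₀ => ?_
  rw [Measure.map_apply measurable_snd (measurableSet_singleton s₀), coupling_apply,
    law_singleton hq' s₀, ← sum_weight_mul_kernelWeight hp hκ s₀,
    ENNReal.ofReal_sum_of_nonneg (fun t _ => mul_nonneg (weight_nonneg hp' t) (kernelWeight_nonneg hp t s₀))]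
  refine Finset.sum_congr rfl fun t _ => ?_
  rw [Finset.sum_eq_single s₀ (fun s _ hs => ?_) (fun h => (h (mem_univ _)).elim)]
  · have hind : (Prod.snd ⁻¹' ({s₀} : Set (Fin 3 → Bool))).indicator
        (1 : (Fin 3 → Bool) × (Fin 3 → Bool) → ℝ≥0∞) (t, s₀) = 1 := by simp
    rw [hind, mul_one]
  · have hind : (Prod.snd ⁻¹' ({s₀} : Set (Fin 3 → Bool))).indicator
        (1 : (Fin 3 → Bool) × (Fin 3 → Bool) → ℝ≥0∞) (t, s) = 0 := by simp [hs]
    rw [hind, mul_zero]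

/-- The coupling is a probability measure (for self-dual `p ∈ [0, 1)³`). [folklore] -/
theorem isProbabilityMeasure_coupling {p : Fin 3 → ℝ} (hp : ∀ k, p k ∈ Set.Ico (0 : ℝ) 1)
    (hκ : kappa p = 0) : IsProbabilityMeasure (coupling p) := by
  have hp' : ∀ k, p k ∈ Set.Icc (0 : ℝ) 1 := fun k => ⟨(hp k).1, (hp k).2.le⟩
  haveI := isProbabilityMeasure_law hp'
  refine ⟨?_⟩
  rw [← Set.preimage_univ (f := (Prod.fst : (Fin 3 → Bool) × (Fin 3 → Bool) → Fin 3 → Bool)),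
    ← Measure.map_apply measurable_fst MeasurableSet.univ, map_fst_coupling hp hκ, measure_univ]

/-! ### Connections among `A, B, C` are preserved -/

/-- **Connection through the triangle**: `i` and `j` are joined by an open path of the triangle
configuration `t` iff `i = j`, or the edge `ij` (the one opposite the third vertex) is open,
or the two other edges (opposite `i` and opposite `j`) are both open. [cite: GrimmettManolescuAOP2013, Prop 2.1] -/
def TriConn (t : Fin 3 → Bool) (i j : Fin 3) : Prop :=
  i = j ∨ (∀ k, k ≠ i → k ≠ j → t k = true) ∨ (t i = true ∧ t j = true)

/-- **Connection through the star**: `i` and `j` are joined by an open path of the star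
configuration `s` iff `i = j` or both star edges `Oi`, `Oj` are open. [cite: GrimmettManolescuAOP2013, Prop 2.1] -/
def StarConn (s : Fin 3 → Bool) (i j : Fin 3) : Prop :=
  i = j ∨ (s i = true ∧ s j = true)

/-- A triangle configuration and a star configuration are *compatible* when they induce the
same connections among `A, B, C` (GM13 Proposition 2.2: "`x ↔ y` in `ω` iff `x ↔ y` in
`T(ω)` for `x, y ∈ {A, B, C}`"; DKKMO: "the coupling preserves the connectivity between the
vertices, except at the vertex `O`"). [cite: GrimmettManolescuAOP2013, Prop 2.2] -/
def Compatible (t s : Fin 3 → Bool) : Prop := ∀ i j, TriConn t i j ↔ StarConn s i j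

/-- `TriConn` is decidable. [folklore] -/
instance (t : Fin 3 → Bool) (i j : Fin 3) : Decidable (TriConn t i j) :=
  inferInstanceAs (Decidable (i = j ∨ (∀ k, k ≠ i → k ≠ j → t k = true) ∨ (t i = true ∧ t j = true)))
/-- `StarConn` is decidable. [folklore] -/
instance (s : Fin 3 → Bool) (i j : Fin 3) : Decidable (StarConn s i j) :=
  inferInstanceAs (Decidable (i = j ∨ (s i = true ∧ s j = true)))
/-- `Compatible` is decidable. [folklore] -/
instance (t s : Fin 3 → Bool) : Decidable (Compatible t s) :=
  inferInstanceAs (Decidable (∀ i j, TriConn t i j ↔ StarConn s i j))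

/-- **The coupling preserves connections** (GM13 Proposition 2.2, second half; DKKMO §2.6):
every transition of positive probability leads to a compatible star configuration. [cite: GrimmettManolescuAOP2013, Prop 2.2] -/
theorem compatible_of_kernelWeight_ne_zero {p : Fin 3 → ℝ} {t s : Fin 3 → Bool}
    (h : kernelWeight p t s ≠ 0) : Compatible t s := by
  obtain ⟨a, b, c, rfl⟩ : ∃ a b c, t = ![a, b, c] := ⟨t 0, t 1, t 2, eq_vec t⟩
  obtain ⟨x, y, z, rfl⟩ : ∃ x y z, s = ![x, y, z] := ⟨s 0, s 1, s 2, eq_vec s⟩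
  cases a <;> cases b <;> cases c <;> cases x <;> cases y <;> cases z <;>
    first
    | decide
    | (exfalso; exact h (by simp [kernelWeight]))

/-- **The coupling is supported on compatible pairs**: the set of pairs inducing different
connections among `A, B, C` is null for `coupling p`. [cite: GrimmettManolescuAOP2013, Prop 2.2] -/
theorem coupling_not_compatible (p : Fin 3 → ℝ) :
    coupling p {x | ¬ Compatible x.1 x.2} = 0 := by
  rw [coupling_apply]
  refine Finset.sum_eq_zero fun t _ => Finset.sum_eq_zero fun s _ => ?_
  by_cases h : kernelWeight p t s = 0
  · rw [h, mul_zero, ENNReal.ofReal_zero, zero_mul]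
  · have hc : Compatible t s := compatible_of_kernelWeight_ne_zero h
    have : ({x : (Fin 3 → Bool) × (Fin 3 → Bool) | ¬ Compatible x.1 x.2}).indicator
        (1 : (Fin 3 → Bool) × (Fin 3 → Bool) → ℝ≥0∞) (t, s) = 0 := by
      simp [hc]
    rw [this, mul_zero]

/-- **Star–triangle transformation** (GM13 Proposition 2.1; Grimmett 1999, §11.9): for
self-dual `p ∈ [0, 1)³`, the family of connection events among `A, B, C` has the same law
under `P^△_p` (through the triangle) as under `P^☆_{1−p}` (through the star): for every set
`E` of connection patterns `Fin 3 → Fin 3 → Prop`,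
`P^△_p{t | TriConn t ∈ E} = P^☆_{1−p}{s | StarConn s ∈ E}`. Proof: both are the mass of
`{(t, s) | TriConn t ∈ E}` resp. `{(t, s) | StarConn s ∈ E}` under the coupling, and these
two events differ only on incompatible pairs, a null set. [cite: GrimmettManolescuAOP2013, Prop 2.1] -/
theorem law_triConn_eq_law_starConn {p : Fin 3 → ℝ} (hp : ∀ k, p k ∈ Set.Ico (0 : ℝ) 1)
    (hκ : kappa p = 0) (E : Set (Fin 3 → Fin 3 → Prop)) :
    law p {t | TriConn t ∈ E} = law (fun k => 1 - p k) {s | StarConn s ∈ E} := by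
  rw [← map_fst_coupling hp hκ, ← map_snd_coupling hp hκ,
    Measure.map_apply measurable_fst (Set.to_countable _).measurableSet,
    Measure.map_apply measurable_snd (Set.to_countable _).measurableSet]
  have key : ∀ x : (Fin 3 → Bool) × (Fin 3 → Bool), Compatible x.1 x.2 →
      (x ∈ Prod.fst ⁻¹' {t : Fin 3 → Bool | TriConn t ∈ E} ↔ x ∈ Prod.snd ⁻¹' {s : Fin 3 → Bool | StarConn s ∈ E}) := by
    intro x hc
    have : TriConn x.1 = StarConn x.2 := funext fun i => funext fun j => propext (hc i j)
    simp only [Set.mem_preimage, Set.mem_setOf_eq, this]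
  refine measure_congr (ae_eq_set.2 ⟨?_, ?_⟩)
  · exact measure_mono_null (fun x hx hc => hx.2 ((key x hc).1 hx.1)) (coupling_not_compatible p)
  · exact measure_mono_null (fun x hx hc => hx.2 ((key x hc).2 hx.1)) (coupling_not_compatible p)

/-! ### The connection predicates are graph connectivity -/

/-- The open subgraph of the triangle `ABC` in the configuration `t`: `i ∼ j` iff `i ≠ j` and the
edge `ij` — the one opposite the third vertex — is open (`triGraph_adj`). [folklore] -/
def triGraph (t : Fin 3 → Bool) : SimpleGraph (Fin 3) :=
  SimpleGraph.fromRel fun i j => ∀ k, k ≠ i → k ≠ j → t k = true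

/-- Adjacency in the open triangle. [folklore] -/
theorem triGraph_adj (t : Fin 3 → Bool) (i j : Fin 3) :
    (triGraph t).Adj i j ↔ i ≠ j ∧ ∀ k, k ≠ i → k ≠ j → t k = true := by
  rw [triGraph, SimpleGraph.fromRel_adj]
  exact and_congr_right fun _ => ⟨fun h => h.elim id fun h' k hki hkj => h' k hkj hki,
    fun h => Or.inl h⟩

/-- The open subgraph of the star `ABCO` (centre `O = none`) in the configuration `s`: the
centre is joined to the vertex `k` iff the star edge `Ok` is open. [folklore] -/
def starGraph (s : Fin 3 → Bool) : SimpleGraph (Option (Fin 3)) :=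
  SimpleGraph.fromRel fun u v => ∃ k, s k = true ∧ u = none ∧ v = some k

/-- Adjacency in the open triangle is decidable. [folklore] -/
instance (t : Fin 3 → Bool) : DecidableRel (triGraph t).Adj := fun i j =>
  decidable_of_iff _ (SimpleGraph.fromRel_adj _ i j).symm
/-- Adjacency in the open star is decidable. [folklore] -/
instance (s : Fin 3 → Bool) : DecidableRel (starGraph s).Adj := fun u v =>
  decidable_of_iff _ (SimpleGraph.fromRel_adj _ u v).symm

/-- A vertex without neighbours is reachable only from itself. [folklore] -/
theorem eq_of_reachable_of_isolated {V : Type*} {G : SimpleGraph V} {u v : V}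
    (hv : ∀ w, ¬ G.Adj v w) (h : G.Reachable u v) : u = v := by
  obtain ⟨p⟩ := h
  cases hp : p.reverse with
  | nil => rfl
  | cons hadj _ => exact absurd hadj (hv _)

/-- **`TriConn` is connectivity by open paths of the triangle.** [folklore] -/
theorem triConn_iff_reachable (t : Fin 3 → Bool) (i j : Fin 3) :
    TriConn t i j ↔ (triGraph t).Reachable i j := by
  obtain ⟨a, b, c, rfl⟩ : ∃ a b c, t = ![a, b, c] := ⟨t 0, t 1, t 2, eq_vec t⟩
  constructor
  · intro h
    have key : ∀ (a b c : Bool) (i j : Fin 3), TriConn ![a, b, c] i j →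
        i = j ∨ (triGraph ![a, b, c]).Adj i j ∨
          ∃ k, (triGraph ![a, b, c]).Adj i k ∧ (triGraph ![a, b, c]).Adj k j := by
      decide
    rcases key a b c i j h with rfl | h | ⟨k, h1, h2⟩
    · rfl
    · exact h.reachable
    · exact h1.reachable.trans h2.reachable
  · intro h
    by_contra hc
    have key : ∀ (a b c : Bool) (i j : Fin 3), ¬ TriConn ![a, b, c] i j →
        i ≠ j ∧ ((∀ w, ¬ (triGraph ![a, b, c]).Adj i w) ∨ (∀ w, ¬ (triGraph ![a, b, c]).Adj j w)) := by
      decide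
    obtain ⟨hij, hiso | hiso⟩ := key a b c i j hc
    · exact hij (eq_of_reachable_of_isolated hiso h.symm).symm
    · exact hij (eq_of_reachable_of_isolated hiso h)

/-- **`StarConn` is connectivity by open paths of the star** (between the vertices `A, B, C`;
the centre `O` is `none`). [folklore] -/
theorem starConn_iff_reachable (s : Fin 3 → Bool) (i j : Fin 3) :
    StarConn s i j ↔ (starGraph s).Reachable (some i) (some j) := by
  obtain ⟨x, y, z, rfl⟩ : ∃ x y z, s = ![x, y, z] := ⟨s 0, s 1, s 2, eq_vec s⟩
  constructor
  · intro h
    have key : ∀ (x y z : Bool) (i j : Fin 3), StarConn ![x, y, z] i j →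
        i = j ∨ ((starGraph ![x, y, z]).Adj (some i) none ∧ (starGraph ![x, y, z]).Adj none (some j)) := by
      decide
    rcases key x y z i j h with rfl | ⟨h1, h2⟩
    · rfl
    · exact h1.reachable.trans h2.reachable
  · intro h
    by_contra hc
    have key : ∀ (x y z : Bool) (i j : Fin 3), ¬ StarConn ![x, y, z] i j →
        i ≠ j ∧ ((∀ w, ¬ (starGraph ![x, y, z]).Adj (some i) w) ∨
          (∀ w, ¬ (starGraph ![x, y, z]).Adj (some j) w)) := by
      decide
    obtain ⟨hij, hiso | hiso⟩ := key x y z i j hc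
    · exact hij (Option.some_injective _ (eq_of_reachable_of_isolated hiso h.symm).symm)
    · exact hij (Option.some_injective _ (eq_of_reachable_of_isolated hiso h))

/-- `Compatible t s` says exactly that open-path connectivity among `A, B, C` is the same
through the triangle `t` and through the star `s` (GM13 Proposition 2.2: "`x ↔ y` in `ω` iff
`x ↔ y` in `T(ω)`"). [cite: GrimmettManolescuAOP2013, Prop 2.2] -/
theorem compatible_iff_reachable (t s : Fin 3 → Bool) :
    Compatible t s ↔ ∀ i j, (triGraph t).Reachable i j ↔ (starGraph s).Reachable (some i) (some j) := by
  simp only [Compatible, triConn_iff_reachable, starConn_iff_reachable]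

end StarTriangle

end Literature.Probability.Percolation

end
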